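import Summits.QuantumFields.BalabanUV.Beta.EriceRemainderEnclosureHistoryAutonomyComparisonAgeCompositionNestedTwoPairsNear

/-!
# EriceRemainderEnclosureHistoryAutonomyComparisonAgeCompositionTwoPairsBandsG — (E93j) route (N), first order: RATIONAL BANDS OF THE JOINT TWO-PAIR CERTIFICATE, NEAR REGIME (ratio below 2), PART G.
# Instances of (E93c) `flow_nonneg_census_three_ages_two_pairs_near` for bands `K_lo ≤ k₂ ≤ K_hi`, `K3_lo ≤ k₃ ≤ K3_hi` inside `57 ≤ k₃ ≤ 2k₂+1`
# (`28 ≤ k₂ ≤ 44`): worst-case rational parameters `s = 0.70715`, `σ₁`, `σ₂` (from `p₂⁴(K3_hi+1) ≤ K_lo+1`), `E = 2(K_hi+1)∕K3_lo ≥ 1`, `B = 4∕K_lo`,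
# `C = 4∕K3_lo`, and exact rational certificate data with the CONVEX middle residual flattened at its vertex (generator
# `HOME/b2b-balaban-beta-d4-p2/g83/numerics/band_lean.py`, `band_near.py`).  THE END `0 ≤ ε ≤ e` along every admissible flow, every horizon, every
# damping of the self-consistent class, for every `(k₂, k₃)` of the band

Cell `pub-balaban`, β-function sub-cell, BINDER row D4 «RemainderConst leaves for Bałaban's split» (`HOME/BINDER-OWNERS.md`; owner lineage `b2b-balaban-beta-an4`;
this file by co-owner #2 lineage `b2b-balaban-beta-d4-p2`, generation 83), β-FLOW TEAM duty (1), FREEZE (0) honoured (def-free; nothing restated).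

HONEST FRAMING (page 1, verbatim and binding).  *"Discharging BetaPertH makes Bałaban's UV stability UNCONDITIONAL — a real constructive-QFT result; it is
NOT the continuum limit and NOT the Clay problem."*  THIS FILE DISCHARGES NOTHING OF THE KIND.  Elementary real algebra ∕ real analysis about ABSTRACT
functionals on a box ]0,γ]^ℕ with displayed floors, profiles and signs, and the FIRST-ORDER renewal objects of route (N) built from them — hypotheses of a
census, not facts; the form, signs, ages and moments of Bałaban's (1.22) limit functional are NOT PRINTED ([I] p. 298; GAPS G-t4-U2-1∕-2) and NOT asserted.
Row D4 class UNCHANGED (critical-path width 0; instance 0∕1; D4 DISCHARGE NO DATE); NOT B12 Thm 2, NOT BetaPertH, NOT continuum, NOT Clay.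

WHAT IS PROVED ([folklore]; 0 `def`, 0 sorry).  `joint_near_band_k40_41_57_70`, `joint_near_band_k40_41_71_83`, `joint_near_band_k42_43_57_72`, `joint_near_band_k42_43_73_87`, `joint_near_band_k44_44_57_73`, `joint_near_band_k44_44_74_89`.
-/
noncomputable section
open Finset

namespace Summit.QuantumFields.BalabanUV.Beta.EriceRemainderEnclosureHistoryAutonomyComparisonAgeCompositionTwoPairsBandsG

open Literature.MathematicalPhysics.QuantumFieldTheory.Balaban1983to89
open Literature.MathematicalPhysics.QuantumFieldTheory.Balaban1983to89.T4BetaStationary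
open Literature.MathematicalPhysics.QuantumFieldTheory.Balaban1983to89.T4BetaFlowWellPosed
open Summit.QuantumFields.BalabanUV.Beta.EriceRemainderEnclosureHistoryAutonomyComparisonAgeCompositionNestedTwoPairsNear (flow_nonneg_census_three_ages_two_pairs_near)

variable {B : (ℕ → ℝ) → ℝ} {γ b gIR : ℝ} {L : ℕ → ℝ} {K : ℕ} {h g : ℕ → ℝ}

/-- **NEAR BAND `40 ≤ k₂ ≤ 41`, `57 ≤ k₃ ≤ 70` (ratio below 2) ⟹ THE END** ((E93c) `flow_nonneg_census_three_ages_two_pairs_near` with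
`s = 14143/20000`, `p₁ = 4671/10000`, `σ₁ = 96401/100000`, `p₂ = 8717/10000`, `σ₂ = 37781/50000`, `E = 28/19`, `B = 1/10`, `C = 4/57`; exact rational certificate, margin `0.0089`). [folklore] -/
theorem joint_near_band_k40_41_57_70 (hmono : ∀ u v : ℕ → ℝ, SeqBox γ u → SeqBox γ v → (∀ j, u j ≤ v j) → B u ≤ B v)
    (hL : ∀ k, 0 ≤ L k) (hb : 0 < b) (hlo : ∀ u, SeqBox γ u → b ≤ B u) (hdom : ∀ u, SeqBox γ u → ∑ k ∈ range K, L k * u k ≤ B u)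
    (hh : SeqBox γ h) (hf : MemFlow B gIR h) (hg : ∀ t, 0 < g t ∧ g t ≤ 1)
    (hgF : ∀ t, 1 ≤ g t * (1 + ∑ k ∈ range K, L k * h (t + k) ^ 3 / 2))
    {k₂ k₃ : ℕ} (hk2lo : 40 ≤ k₂) (hk2hi : k₂ ≤ 41) (hk3lo : 57 ≤ k₃) (hk3hi : k₃ ≤ 70) (hk3K : k₃ < K)
    (hL3 : ∀ j, j < K → j ≠ 1 → j ≠ k₂ → j ≠ k₃ → L j = 0)
    {N : ℕ} {KL : ℕ → ℕ → ℕ → ℝ}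
    (hKL : ∀ k n l, KL k n l = if 0 < k ∧ k < K ∧ l < k then L k * h (n + k) ^ 3 / 2 * ∏ t ∈ Ico (n + 1 + l) (n + k + 1), g t else 0)
    {KA : ℕ → ℕ → ℕ → ℝ} {RA : ℕ → (ℕ → ℝ) → ℕ → ℝ}
    (hRA : ∀ i v m, RA i v m = ∑ l ∈ range K, KA i m l * v (m + 1 + l))
    (hKA : ∀ i m l, KA i m l = KL i m l + KA (i + 1) m l) (hKAtop : ∀ m l, KA K m l = 0)
    {e ε : ℕ → ℝ} (he0 : ∀ m, 0 ≤ e m) (hea : ∀ m, e (m + 1) ≤ e m)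
    (hεt : ∀ m, N < m → ε m = 0) (hεrec : ∀ m, ε m = e m - RA 1 ε m) : ∀ m, 0 ≤ ε m ∧ ε m ≤ e m := by
  have hs99 : Real.sqrt 2 ≤ 99 / 70 := Real.sqrt_le_iff.mpr ⟨by norm_num, by norm_num⟩
  have hk2lo' : (40 : ℝ) ≤ k₂ := by exact_mod_cast hk2lo
  have hk2hi' : (k₂ : ℝ) ≤ 41 := by exact_mod_cast hk2hi
  have hk3lo' : (57 : ℝ) ≤ k₃ := by exact_mod_cast hk3lo
  have hk3hi' : (k₃ : ℝ) ≤ 70 := by exact_mod_cast hk3hi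
  have hk3pos : (0 : ℝ) < k₃ := by exact_mod_cast (show 0 < k₃ by omega)
  refine flow_nonneg_census_three_ages_two_pairs_near hmono hL hb hlo hdom hh hf hg hgF (by omega) (by omega) hk3K hL3
    (p₁ := ((4671 : ℝ) / 10000)) (p₂ := ((8717 : ℝ) / 10000)) (by norm_num) ?_ (by norm_num) ?_
    (s := ((14143 : ℝ) / 20000)) (σ₁ := ((96401 : ℝ) / 100000)) (σ₂ := ((37781 : ℝ) / 50000)) (E := ((28 : ℝ) / 19)) (Bc := ((4 : ℝ) / 40)) (Cc := ((4 : ℝ) / 57))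
    (by linarith [hs99]) (by norm_num) ?_ ?_ ?_ (by norm_num) ?_ ?_ (by norm_num)
    (b₁ := ((4847 : ℝ) / 100000)) (a₂ := ((12843 : ℝ) / 50000)) (ρ₁ := ((8669479911 : ℝ) / 38000000000)) (ρ₂ := ((8669479911 : ℝ) / 38000000000)) (ρ₃ := ((33585564351 : ℝ) / 190000000000)) (ρ₄ := ((33585564351 : ℝ) / 190000000000))
    (Or.inr (by norm_num)) (by norm_num) (by norm_num) (by norm_num)
    (fun h => absurd h (by norm_num)) (fun h => absurd h (by norm_num)) (fun h => absurd h (by norm_num)) (fun h => absurd h (by norm_num))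
    (fun _ => by norm_num) (fun _ => by norm_num) (fun _ => by norm_num)
    (Or.inl (by norm_num)) (by norm_num) (by norm_num) (by norm_num) (by norm_num)
    hKL hRA hKA hKAtop he0 hea hεt hεrec
  · -- p₁⁴(k₂+1) ≤ 2
    have h1 : ((4671 : ℝ) / 10000) ^ 4 * ((k₂ : ℝ) + 1) ≤ ((4671 : ℝ) / 10000) ^ 4 * ((41 : ℝ) + 1) := mul_le_mul_of_nonneg_left (by linarith) (by positivity)
    have h2 : ((4671 : ℝ) / 10000) ^ 4 * ((41 : ℝ) + 1) ≤ 2 := by norm_num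
    linarith
  · -- p₂⁴(k₃+1) ≤ k₂+1
    have h1 : ((8717 : ℝ) / 10000) ^ 4 * ((k₃ : ℝ) + 1) ≤ ((8717 : ℝ) / 10000) ^ 4 * ((70 : ℝ) + 1) := mul_le_mul_of_nonneg_left (by linarith) (by positivity)
    have h2 : ((8717 : ℝ) / 10000) ^ 4 * ((70 : ℝ) + 1) ≤ (40 : ℝ) + 1 := by norm_num
    linarith
  · -- √2∕(1+p₁) ≤ σ₁
    rw [div_le_iff₀ (by norm_num)]; linarith [hs99]
  · -- √2∕(1+p₂) ≤ σ₂
    rw [div_le_iff₀ (by norm_num)]; linarith [hs99]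
  · -- 2(k₂+1)∕k₃ ≤ E
    rw [div_le_iff₀ hk3pos]; nlinarith [hk2hi', hk3lo']
  · -- 4∕k₂ ≤ B
    exact div_le_div_of_nonneg_left (by norm_num) (by norm_num) hk2lo'
  · -- 4∕k₃ ≤ C
    exact div_le_div_of_nonneg_left (by norm_num) (by norm_num) hk3lo'

/-- **NEAR BAND `40 ≤ k₂ ≤ 41`, `71 ≤ k₃ ≤ 83` (ratio below 2) ⟹ THE END** ((E93c) `flow_nonneg_census_three_ages_two_pairs_near` with
`s = 14143/20000`, `p₁ = 4671/10000`, `σ₁ = 96401/100000`, `p₂ = 4179/5000`, `σ₂ = 963/1250`, `E = 84/71`, `B = 1/10`, `C = 4/71`; exact rational certificate, margin `0.0207`). [folklore] -/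
theorem joint_near_band_k40_41_71_83 (hmono : ∀ u v : ℕ → ℝ, SeqBox γ u → SeqBox γ v → (∀ j, u j ≤ v j) → B u ≤ B v)
    (hL : ∀ k, 0 ≤ L k) (hb : 0 < b) (hlo : ∀ u, SeqBox γ u → b ≤ B u) (hdom : ∀ u, SeqBox γ u → ∑ k ∈ range K, L k * u k ≤ B u)
    (hh : SeqBox γ h) (hf : MemFlow B gIR h) (hg : ∀ t, 0 < g t ∧ g t ≤ 1)
    (hgF : ∀ t, 1 ≤ g t * (1 + ∑ k ∈ range K, L k * h (t + k) ^ 3 / 2))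
    {k₂ k₃ : ℕ} (hk2lo : 40 ≤ k₂) (hk2hi : k₂ ≤ 41) (hk3lo : 71 ≤ k₃) (hk3hi : k₃ ≤ 83) (hk3K : k₃ < K)
    (hL3 : ∀ j, j < K → j ≠ 1 → j ≠ k₂ → j ≠ k₃ → L j = 0)
    {N : ℕ} {KL : ℕ → ℕ → ℕ → ℝ}
    (hKL : ∀ k n l, KL k n l = if 0 < k ∧ k < K ∧ l < k then L k * h (n + k) ^ 3 / 2 * ∏ t ∈ Ico (n + 1 + l) (n + k + 1), g t else 0)
    {KA : ℕ → ℕ → ℕ → ℝ} {RA : ℕ → (ℕ → ℝ) → ℕ → ℝ}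
    (hRA : ∀ i v m, RA i v m = ∑ l ∈ range K, KA i m l * v (m + 1 + l))
    (hKA : ∀ i m l, KA i m l = KL i m l + KA (i + 1) m l) (hKAtop : ∀ m l, KA K m l = 0)
    {e ε : ℕ → ℝ} (he0 : ∀ m, 0 ≤ e m) (hea : ∀ m, e (m + 1) ≤ e m)
    (hεt : ∀ m, N < m → ε m = 0) (hεrec : ∀ m, ε m = e m - RA 1 ε m) : ∀ m, 0 ≤ ε m ∧ ε m ≤ e m := by
  have hs99 : Real.sqrt 2 ≤ 99 / 70 := Real.sqrt_le_iff.mpr ⟨by norm_num, by norm_num⟩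
  have hk2lo' : (40 : ℝ) ≤ k₂ := by exact_mod_cast hk2lo
  have hk2hi' : (k₂ : ℝ) ≤ 41 := by exact_mod_cast hk2hi
  have hk3lo' : (71 : ℝ) ≤ k₃ := by exact_mod_cast hk3lo
  have hk3hi' : (k₃ : ℝ) ≤ 83 := by exact_mod_cast hk3hi
  have hk3pos : (0 : ℝ) < k₃ := by exact_mod_cast (show 0 < k₃ by omega)
  refine flow_nonneg_census_three_ages_two_pairs_near hmono hL hb hlo hdom hh hf hg hgF (by omega) (by omega) hk3K hL3
    (p₁ := ((4671 : ℝ) / 10000)) (p₂ := ((4179 : ℝ) / 5000)) (by norm_num) ?_ (by norm_num) ?_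
    (s := ((14143 : ℝ) / 20000)) (σ₁ := ((96401 : ℝ) / 100000)) (σ₂ := ((963 : ℝ) / 1250)) (E := ((84 : ℝ) / 71)) (Bc := ((4 : ℝ) / 40)) (Cc := ((4 : ℝ) / 71))
    (by linarith [hs99]) (by norm_num) ?_ ?_ ?_ (by norm_num) ?_ ?_ (by norm_num)
    (b₁ := ((253 : ℝ) / 4000)) (a₂ := ((12843 : ℝ) / 50000)) (ρ₁ := ((1257611673 : ℝ) / 5680000000)) (ρ₂ := ((1257611673 : ℝ) / 5680000000)) (ρ₃ := ((89829203 : ℝ) / 443750000)) (ρ₄ := ((89829203 : ℝ) / 443750000))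
    (Or.inr (by norm_num)) (by norm_num) (by norm_num) (by norm_num)
    (fun h => absurd h (by norm_num)) (fun h => absurd h (by norm_num)) (fun h => absurd h (by norm_num)) (fun h => absurd h (by norm_num))
    (fun _ => by norm_num) (fun _ => by norm_num) (fun _ => by norm_num)
    (Or.inl (by norm_num)) (by norm_num) (by norm_num) (by norm_num) (by norm_num)
    hKL hRA hKA hKAtop he0 hea hεt hεrec
  · -- p₁⁴(k₂+1) ≤ 2
    have h1 : ((4671 : ℝ) / 10000) ^ 4 * ((k₂ : ℝ) + 1) ≤ ((4671 : ℝ) / 10000) ^ 4 * ((41 : ℝ) + 1) := mul_le_mul_of_nonneg_left (by linarith) (by positivity)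
    have h2 : ((4671 : ℝ) / 10000) ^ 4 * ((41 : ℝ) + 1) ≤ 2 := by norm_num
    linarith
  · -- p₂⁴(k₃+1) ≤ k₂+1
    have h1 : ((4179 : ℝ) / 5000) ^ 4 * ((k₃ : ℝ) + 1) ≤ ((4179 : ℝ) / 5000) ^ 4 * ((83 : ℝ) + 1) := mul_le_mul_of_nonneg_left (by linarith) (by positivity)
    have h2 : ((4179 : ℝ) / 5000) ^ 4 * ((83 : ℝ) + 1) ≤ (40 : ℝ) + 1 := by norm_num
    linarith
  · -- √2∕(1+p₁) ≤ σ₁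
    rw [div_le_iff₀ (by norm_num)]; linarith [hs99]
  · -- √2∕(1+p₂) ≤ σ₂
    rw [div_le_iff₀ (by norm_num)]; linarith [hs99]
  · -- 2(k₂+1)∕k₃ ≤ E
    rw [div_le_iff₀ hk3pos]; nlinarith [hk2hi', hk3lo']
  · -- 4∕k₂ ≤ B
    exact div_le_div_of_nonneg_left (by norm_num) (by norm_num) hk2lo'
  · -- 4∕k₃ ≤ C
    exact div_le_div_of_nonneg_left (by norm_num) (by norm_num) hk3lo'

/-- **NEAR BAND `42 ≤ k₂ ≤ 43`, `57 ≤ k₃ ≤ 72` (ratio below 2) ⟹ THE END** ((E93c) `flow_nonneg_census_three_ages_two_pairs_near` with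
`s = 14143/20000`, `p₁ = 4617/10000`, `σ₁ = 96757/100000`, `p₂ = 219/250`, `σ₂ = 75389/100000`, `E = 88/57`, `B = 2/21`, `C = 4/57`; exact rational certificate, margin `0.0074`). [folklore] -/
theorem joint_near_band_k42_43_57_72 (hmono : ∀ u v : ℕ → ℝ, SeqBox γ u → SeqBox γ v → (∀ j, u j ≤ v j) → B u ≤ B v)
    (hL : ∀ k, 0 ≤ L k) (hb : 0 < b) (hlo : ∀ u, SeqBox γ u → b ≤ B u) (hdom : ∀ u, SeqBox γ u → ∑ k ∈ range K, L k * u k ≤ B u)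
    (hh : SeqBox γ h) (hf : MemFlow B gIR h) (hg : ∀ t, 0 < g t ∧ g t ≤ 1)
    (hgF : ∀ t, 1 ≤ g t * (1 + ∑ k ∈ range K, L k * h (t + k) ^ 3 / 2))
    {k₂ k₃ : ℕ} (hk2lo : 42 ≤ k₂) (hk2hi : k₂ ≤ 43) (hk3lo : 57 ≤ k₃) (hk3hi : k₃ ≤ 72) (hk3K : k₃ < K)
    (hL3 : ∀ j, j < K → j ≠ 1 → j ≠ k₂ → j ≠ k₃ → L j = 0)
    {N : ℕ} {KL : ℕ → ℕ → ℕ → ℝ}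
    (hKL : ∀ k n l, KL k n l = if 0 < k ∧ k < K ∧ l < k then L k * h (n + k) ^ 3 / 2 * ∏ t ∈ Ico (n + 1 + l) (n + k + 1), g t else 0)
    {KA : ℕ → ℕ → ℕ → ℝ} {RA : ℕ → (ℕ → ℝ) → ℕ → ℝ}
    (hRA : ∀ i v m, RA i v m = ∑ l ∈ range K, KA i m l * v (m + 1 + l))
    (hKA : ∀ i m l, KA i m l = KL i m l + KA (i + 1) m l) (hKAtop : ∀ m l, KA K m l = 0)
    {e ε : ℕ → ℝ} (he0 : ∀ m, 0 ≤ e m) (hea : ∀ m, e (m + 1) ≤ e m)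
    (hεt : ∀ m, N < m → ε m = 0) (hεrec : ∀ m, ε m = e m - RA 1 ε m) : ∀ m, 0 ≤ ε m ∧ ε m ≤ e m := by
  have hs99 : Real.sqrt 2 ≤ 99 / 70 := Real.sqrt_le_iff.mpr ⟨by norm_num, by norm_num⟩
  have hk2lo' : (42 : ℝ) ≤ k₂ := by exact_mod_cast hk2lo
  have hk2hi' : (k₂ : ℝ) ≤ 43 := by exact_mod_cast hk2hi
  have hk3lo' : (57 : ℝ) ≤ k₃ := by exact_mod_cast hk3lo
  have hk3hi' : (k₃ : ℝ) ≤ 72 := by exact_mod_cast hk3hi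
  have hk3pos : (0 : ℝ) < k₃ := by exact_mod_cast (show 0 < k₃ by omega)
  refine flow_nonneg_census_three_ages_two_pairs_near hmono hL hb hlo hdom hh hf hg hgF (by omega) (by omega) hk3K hL3
    (p₁ := ((4617 : ℝ) / 10000)) (p₂ := ((219 : ℝ) / 250)) (by norm_num) ?_ (by norm_num) ?_
    (s := ((14143 : ℝ) / 20000)) (σ₁ := ((96757 : ℝ) / 100000)) (σ₂ := ((75389 : ℝ) / 100000)) (E := ((88 : ℝ) / 57)) (Bc := ((4 : ℝ) / 42)) (Cc := ((4 : ℝ) / 57))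
    (by linarith [hs99]) (by norm_num) ?_ ?_ ?_ (by norm_num) ?_ ?_ (by norm_num)
    (b₁ := ((2337 : ℝ) / 50000)) (a₂ := ((13021 : ℝ) / 50000)) (ρ₁ := ((228134247 : ℝ) / 1000000000)) (ρ₂ := ((228134247 : ℝ) / 1000000000)) (ρ₃ := ((384942259049 : ℝ) / 2280000000000)) (ρ₄ := ((384942259049 : ℝ) / 2280000000000))
    (Or.inr (by norm_num)) (by norm_num) (by norm_num) (by norm_num)
    (fun h => absurd h (by norm_num)) (fun h => absurd h (by norm_num)) (fun h => absurd h (by norm_num)) (fun h => absurd h (by norm_num))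
    (fun _ => by norm_num) (fun _ => by norm_num) (fun _ => by norm_num)
    (Or.inl (by norm_num)) (by norm_num) (by norm_num) (by norm_num) (by norm_num)
    hKL hRA hKA hKAtop he0 hea hεt hεrec
  · -- p₁⁴(k₂+1) ≤ 2
    have h1 : ((4617 : ℝ) / 10000) ^ 4 * ((k₂ : ℝ) + 1) ≤ ((4617 : ℝ) / 10000) ^ 4 * ((43 : ℝ) + 1) := mul_le_mul_of_nonneg_left (by linarith) (by positivity)
    have h2 : ((4617 : ℝ) / 10000) ^ 4 * ((43 : ℝ) + 1) ≤ 2 := by norm_num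
    linarith
  · -- p₂⁴(k₃+1) ≤ k₂+1
    have h1 : ((219 : ℝ) / 250) ^ 4 * ((k₃ : ℝ) + 1) ≤ ((219 : ℝ) / 250) ^ 4 * ((72 : ℝ) + 1) := mul_le_mul_of_nonneg_left (by linarith) (by positivity)
    have h2 : ((219 : ℝ) / 250) ^ 4 * ((72 : ℝ) + 1) ≤ (42 : ℝ) + 1 := by norm_num
    linarith
  · -- √2∕(1+p₁) ≤ σ₁
    rw [div_le_iff₀ (by norm_num)]; linarith [hs99]
  · -- √2∕(1+p₂) ≤ σ₂
    rw [div_le_iff₀ (by norm_num)]; linarith [hs99]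
  · -- 2(k₂+1)∕k₃ ≤ E
    rw [div_le_iff₀ hk3pos]; nlinarith [hk2hi', hk3lo']
  · -- 4∕k₂ ≤ B
    exact div_le_div_of_nonneg_left (by norm_num) (by norm_num) hk2lo'
  · -- 4∕k₃ ≤ C
    exact div_le_div_of_nonneg_left (by norm_num) (by norm_num) hk3lo'

/-- **NEAR BAND `42 ≤ k₂ ≤ 43`, `73 ≤ k₃ ≤ 87` (ratio below 2) ⟹ THE END** ((E93c) `flow_nonneg_census_three_ages_two_pairs_near` with
`s = 14143/20000`, `p₁ = 4617/10000`, `σ₁ = 96757/100000`, `p₂ = 209/250`, `σ₂ = 77031/100000`, `E = 88/73`, `B = 2/21`, `C = 4/73`; exact rational certificate, margin `0.0210`). [folklore] -/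
theorem joint_near_band_k42_43_73_87 (hmono : ∀ u v : ℕ → ℝ, SeqBox γ u → SeqBox γ v → (∀ j, u j ≤ v j) → B u ≤ B v)
    (hL : ∀ k, 0 ≤ L k) (hb : 0 < b) (hlo : ∀ u, SeqBox γ u → b ≤ B u) (hdom : ∀ u, SeqBox γ u → ∑ k ∈ range K, L k * u k ≤ B u)
    (hh : SeqBox γ h) (hf : MemFlow B gIR h) (hg : ∀ t, 0 < g t ∧ g t ≤ 1)
    (hgF : ∀ t, 1 ≤ g t * (1 + ∑ k ∈ range K, L k * h (t + k) ^ 3 / 2))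
    {k₂ k₃ : ℕ} (hk2lo : 42 ≤ k₂) (hk2hi : k₂ ≤ 43) (hk3lo : 73 ≤ k₃) (hk3hi : k₃ ≤ 87) (hk3K : k₃ < K)
    (hL3 : ∀ j, j < K → j ≠ 1 → j ≠ k₂ → j ≠ k₃ → L j = 0)
    {N : ℕ} {KL : ℕ → ℕ → ℕ → ℝ}
    (hKL : ∀ k n l, KL k n l = if 0 < k ∧ k < K ∧ l < k then L k * h (n + k) ^ 3 / 2 * ∏ t ∈ Ico (n + 1 + l) (n + k + 1), g t else 0)
    {KA : ℕ → ℕ → ℕ → ℝ} {RA : ℕ → (ℕ → ℝ) → ℕ → ℝ}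
    (hRA : ∀ i v m, RA i v m = ∑ l ∈ range K, KA i m l * v (m + 1 + l))
    (hKA : ∀ i m l, KA i m l = KL i m l + KA (i + 1) m l) (hKAtop : ∀ m l, KA K m l = 0)
    {e ε : ℕ → ℝ} (he0 : ∀ m, 0 ≤ e m) (hea : ∀ m, e (m + 1) ≤ e m)
    (hεt : ∀ m, N < m → ε m = 0) (hεrec : ∀ m, ε m = e m - RA 1 ε m) : ∀ m, 0 ≤ ε m ∧ ε m ≤ e m := by
  have hs99 : Real.sqrt 2 ≤ 99 / 70 := Real.sqrt_le_iff.mpr ⟨by norm_num, by norm_num⟩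
  have hk2lo' : (42 : ℝ) ≤ k₂ := by exact_mod_cast hk2lo
  have hk2hi' : (k₂ : ℝ) ≤ 43 := by exact_mod_cast hk2hi
  have hk3lo' : (73 : ℝ) ≤ k₃ := by exact_mod_cast hk3lo
  have hk3hi' : (k₃ : ℝ) ≤ 87 := by exact_mod_cast hk3hi
  have hk3pos : (0 : ℝ) < k₃ := by exact_mod_cast (show 0 < k₃ by omega)
  refine flow_nonneg_census_three_ages_two_pairs_near hmono hL hb hlo hdom hh hf hg hgF (by omega) (by omega) hk3K hL3
    (p₁ := ((4617 : ℝ) / 10000)) (p₂ := ((209 : ℝ) / 250)) (by norm_num) ?_ (by norm_num) ?_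
    (s := ((14143 : ℝ) / 20000)) (σ₁ := ((96757 : ℝ) / 100000)) (σ₂ := ((77031 : ℝ) / 100000)) (E := ((88 : ℝ) / 73)) (Bc := ((4 : ℝ) / 42)) (Cc := ((4 : ℝ) / 73))
    (by linarith [hs99]) (by norm_num) ?_ ?_ ?_ (by norm_num) ?_ ?_ (by norm_num)
    (b₁ := ((1579 : ℝ) / 25000)) (a₂ := ((13021 : ℝ) / 50000)) (ρ₁ := ((1609741609 : ℝ) / 7300000000)) (ρ₂ := ((1609741609 : ℝ) / 7300000000)) (ρ₃ := ((116337635117 : ℝ) / 584000000000)) (ρ₄ := ((116337635117 : ℝ) / 584000000000))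
    (Or.inr (by norm_num)) (by norm_num) (by norm_num) (by norm_num)
    (fun h => absurd h (by norm_num)) (fun h => absurd h (by norm_num)) (fun h => absurd h (by norm_num)) (fun h => absurd h (by norm_num))
    (fun _ => by norm_num) (fun _ => by norm_num) (fun _ => by norm_num)
    (Or.inl (by norm_num)) (by norm_num) (by norm_num) (by norm_num) (by norm_num)
    hKL hRA hKA hKAtop he0 hea hεt hεrec
  · -- p₁⁴(k₂+1) ≤ 2
    have h1 : ((4617 : ℝ) / 10000) ^ 4 * ((k₂ : ℝ) + 1) ≤ ((4617 : ℝ) / 10000) ^ 4 * ((43 : ℝ) + 1) := mul_le_mul_of_nonneg_left (by linarith) (by positivity)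
    have h2 : ((4617 : ℝ) / 10000) ^ 4 * ((43 : ℝ) + 1) ≤ 2 := by norm_num
    linarith
  · -- p₂⁴(k₃+1) ≤ k₂+1
    have h1 : ((209 : ℝ) / 250) ^ 4 * ((k₃ : ℝ) + 1) ≤ ((209 : ℝ) / 250) ^ 4 * ((87 : ℝ) + 1) := mul_le_mul_of_nonneg_left (by linarith) (by positivity)
    have h2 : ((209 : ℝ) / 250) ^ 4 * ((87 : ℝ) + 1) ≤ (42 : ℝ) + 1 := by norm_num
    linarith
  · -- √2∕(1+p₁) ≤ σ₁
    rw [div_le_iff₀ (by norm_num)]; linarith [hs99]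
  · -- √2∕(1+p₂) ≤ σ₂
    rw [div_le_iff₀ (by norm_num)]; linarith [hs99]
  · -- 2(k₂+1)∕k₃ ≤ E
    rw [div_le_iff₀ hk3pos]; nlinarith [hk2hi', hk3lo']
  · -- 4∕k₂ ≤ B
    exact div_le_div_of_nonneg_left (by norm_num) (by norm_num) hk2lo'
  · -- 4∕k₃ ≤ C
    exact div_le_div_of_nonneg_left (by norm_num) (by norm_num) hk3lo'

/-- **NEAR BAND `44 ≤ k₂ ≤ 44`, `57 ≤ k₃ ≤ 73` (ratio below 2) ⟹ THE END** ((E93c) `flow_nonneg_census_three_ages_two_pairs_near` with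
`s = 14143/20000`, `p₁ = 4591/10000`, `σ₁ = 96929/100000`, `p₂ = 883/1000`, `σ₂ = 75109/100000`, `E = 30/19`, `B = 1/11`, `C = 4/57`; exact rational certificate, margin `0.0079`). [folklore] -/
theorem joint_near_band_k44_44_57_73 (hmono : ∀ u v : ℕ → ℝ, SeqBox γ u → SeqBox γ v → (∀ j, u j ≤ v j) → B u ≤ B v)
    (hL : ∀ k, 0 ≤ L k) (hb : 0 < b) (hlo : ∀ u, SeqBox γ u → b ≤ B u) (hdom : ∀ u, SeqBox γ u → ∑ k ∈ range K, L k * u k ≤ B u)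
    (hh : SeqBox γ h) (hf : MemFlow B gIR h) (hg : ∀ t, 0 < g t ∧ g t ≤ 1)
    (hgF : ∀ t, 1 ≤ g t * (1 + ∑ k ∈ range K, L k * h (t + k) ^ 3 / 2))
    {k₂ k₃ : ℕ} (hk2lo : 44 ≤ k₂) (hk2hi : k₂ ≤ 44) (hk3lo : 57 ≤ k₃) (hk3hi : k₃ ≤ 73) (hk3K : k₃ < K)
    (hL3 : ∀ j, j < K → j ≠ 1 → j ≠ k₂ → j ≠ k₃ → L j = 0)
    {N : ℕ} {KL : ℕ → ℕ → ℕ → ℝ}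
    (hKL : ∀ k n l, KL k n l = if 0 < k ∧ k < K ∧ l < k then L k * h (n + k) ^ 3 / 2 * ∏ t ∈ Ico (n + 1 + l) (n + k + 1), g t else 0)
    {KA : ℕ → ℕ → ℕ → ℝ} {RA : ℕ → (ℕ → ℝ) → ℕ → ℝ}
    (hRA : ∀ i v m, RA i v m = ∑ l ∈ range K, KA i m l * v (m + 1 + l))
    (hKA : ∀ i m l, KA i m l = KL i m l + KA (i + 1) m l) (hKAtop : ∀ m l, KA K m l = 0)
    {e ε : ℕ → ℝ} (he0 : ∀ m, 0 ≤ e m) (hea : ∀ m, e (m + 1) ≤ e m)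
    (hεt : ∀ m, N < m → ε m = 0) (hεrec : ∀ m, ε m = e m - RA 1 ε m) : ∀ m, 0 ≤ ε m ∧ ε m ≤ e m := by
  have hs99 : Real.sqrt 2 ≤ 99 / 70 := Real.sqrt_le_iff.mpr ⟨by norm_num, by norm_num⟩
  have hk2lo' : (44 : ℝ) ≤ k₂ := by exact_mod_cast hk2lo
  have hk2hi' : (k₂ : ℝ) ≤ 44 := by exact_mod_cast hk2hi
  have hk3lo' : (57 : ℝ) ≤ k₃ := by exact_mod_cast hk3lo
  have hk3hi' : (k₃ : ℝ) ≤ 73 := by exact_mod_cast hk3hi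
  have hk3pos : (0 : ℝ) < k₃ := by exact_mod_cast (show 0 < k₃ by omega)
  refine flow_nonneg_census_three_ages_two_pairs_near hmono hL hb hlo hdom hh hf hg hgF (by omega) (by omega) hk3K hL3
    (p₁ := ((4591 : ℝ) / 10000)) (p₂ := ((883 : ℝ) / 1000)) (by norm_num) ?_ (by norm_num) ?_
    (s := ((14143 : ℝ) / 20000)) (σ₁ := ((96929 : ℝ) / 100000)) (σ₂ := ((75109 : ℝ) / 100000)) (E := ((30 : ℝ) / 19)) (Bc := ((4 : ℝ) / 44)) (Cc := ((4 : ℝ) / 57))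
    (by linarith [hs99]) (by norm_num) ?_ ?_ ?_ (by norm_num) ?_ ?_ (by norm_num)
    (b₁ := ((2197 : ℝ) / 50000)) (a₂ := ((13107 : ℝ) / 50000)) (ρ₁ := ((4387496119 : ℝ) / 19000000000)) (ρ₂ := ((4387496119 : ℝ) / 19000000000)) (ρ₃ := ((127116619309 : ℝ) / 760000000000)) (ρ₄ := ((127116619309 : ℝ) / 760000000000))
    (Or.inr (by norm_num)) (by norm_num) (by norm_num) (by norm_num)
    (fun h => absurd h (by norm_num)) (fun h => absurd h (by norm_num)) (fun h => absurd h (by norm_num)) (fun h => absurd h (by norm_num))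
    (fun _ => by norm_num) (fun _ => by norm_num) (fun _ => by norm_num)
    (Or.inl (by norm_num)) (by norm_num) (by norm_num) (by norm_num) (by norm_num)
    hKL hRA hKA hKAtop he0 hea hεt hεrec
  · -- p₁⁴(k₂+1) ≤ 2
    have h1 : ((4591 : ℝ) / 10000) ^ 4 * ((k₂ : ℝ) + 1) ≤ ((4591 : ℝ) / 10000) ^ 4 * ((44 : ℝ) + 1) := mul_le_mul_of_nonneg_left (by linarith) (by positivity)
    have h2 : ((4591 : ℝ) / 10000) ^ 4 * ((44 : ℝ) + 1) ≤ 2 := by norm_num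
    linarith
  · -- p₂⁴(k₃+1) ≤ k₂+1
    have h1 : ((883 : ℝ) / 1000) ^ 4 * ((k₃ : ℝ) + 1) ≤ ((883 : ℝ) / 1000) ^ 4 * ((73 : ℝ) + 1) := mul_le_mul_of_nonneg_left (by linarith) (by positivity)
    have h2 : ((883 : ℝ) / 1000) ^ 4 * ((73 : ℝ) + 1) ≤ (44 : ℝ) + 1 := by norm_num
    linarith
  · -- √2∕(1+p₁) ≤ σ₁
    rw [div_le_iff₀ (by norm_num)]; linarith [hs99]
  · -- √2∕(1+p₂) ≤ σ₂
    rw [div_le_iff₀ (by norm_num)]; linarith [hs99]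
  · -- 2(k₂+1)∕k₃ ≤ E
    rw [div_le_iff₀ hk3pos]; nlinarith [hk2hi', hk3lo']
  · -- 4∕k₂ ≤ B
    exact div_le_div_of_nonneg_left (by norm_num) (by norm_num) hk2lo'
  · -- 4∕k₃ ≤ C
    exact div_le_div_of_nonneg_left (by norm_num) (by norm_num) hk3lo'

/-- **NEAR BAND `44 ≤ k₂ ≤ 44`, `74 ≤ k₃ ≤ 89` (ratio below 2) ⟹ THE END** ((E93c) `flow_nonneg_census_three_ages_two_pairs_near` with
`s = 14143/20000`, `p₁ = 4591/10000`, `σ₁ = 96929/100000`, `p₂ = 1051/1250`, `σ₂ = 7683/10000`, `E = 45/37`, `B = 1/11`, `C = 2/37`; exact rational certificate, margin `0.0223`). [folklore] -/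
theorem joint_near_band_k44_44_74_89 (hmono : ∀ u v : ℕ → ℝ, SeqBox γ u → SeqBox γ v → (∀ j, u j ≤ v j) → B u ≤ B v)
    (hL : ∀ k, 0 ≤ L k) (hb : 0 < b) (hlo : ∀ u, SeqBox γ u → b ≤ B u) (hdom : ∀ u, SeqBox γ u → ∑ k ∈ range K, L k * u k ≤ B u)
    (hh : SeqBox γ h) (hf : MemFlow B gIR h) (hg : ∀ t, 0 < g t ∧ g t ≤ 1)
    (hgF : ∀ t, 1 ≤ g t * (1 + ∑ k ∈ range K, L k * h (t + k) ^ 3 / 2))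
    {k₂ k₃ : ℕ} (hk2lo : 44 ≤ k₂) (hk2hi : k₂ ≤ 44) (hk3lo : 74 ≤ k₃) (hk3hi : k₃ ≤ 89) (hk3K : k₃ < K)
    (hL3 : ∀ j, j < K → j ≠ 1 → j ≠ k₂ → j ≠ k₃ → L j = 0)
    {N : ℕ} {KL : ℕ → ℕ → ℕ → ℝ}
    (hKL : ∀ k n l, KL k n l = if 0 < k ∧ k < K ∧ l < k then L k * h (n + k) ^ 3 / 2 * ∏ t ∈ Ico (n + 1 + l) (n + k + 1), g t else 0)
    {KA : ℕ → ℕ → ℕ → ℝ} {RA : ℕ → (ℕ → ℝ) → ℕ → ℝ}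
    (hRA : ∀ i v m, RA i v m = ∑ l ∈ range K, KA i m l * v (m + 1 + l))
    (hKA : ∀ i m l, KA i m l = KL i m l + KA (i + 1) m l) (hKAtop : ∀ m l, KA K m l = 0)
    {e ε : ℕ → ℝ} (he0 : ∀ m, 0 ≤ e m) (hea : ∀ m, e (m + 1) ≤ e m)
    (hεt : ∀ m, N < m → ε m = 0) (hεrec : ∀ m, ε m = e m - RA 1 ε m) : ∀ m, 0 ≤ ε m ∧ ε m ≤ e m := by
  have hs99 : Real.sqrt 2 ≤ 99 / 70 := Real.sqrt_le_iff.mpr ⟨by norm_num, by norm_num⟩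
  have hk2lo' : (44 : ℝ) ≤ k₂ := by exact_mod_cast hk2lo
  have hk2hi' : (k₂ : ℝ) ≤ 44 := by exact_mod_cast hk2hi
  have hk3lo' : (74 : ℝ) ≤ k₃ := by exact_mod_cast hk3lo
  have hk3hi' : (k₃ : ℝ) ≤ 89 := by exact_mod_cast hk3hi
  have hk3pos : (0 : ℝ) < k₃ := by exact_mod_cast (show 0 < k₃ by omega)
  refine flow_nonneg_census_three_ages_two_pairs_near hmono hL hb hlo hdom hh hf hg hgF (by omega) (by omega) hk3K hL3
    (p₁ := ((4591 : ℝ) / 10000)) (p₂ := ((1051 : ℝ) / 1250)) (by norm_num) ?_ (by norm_num) ?_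
    (s := ((14143 : ℝ) / 20000)) (σ₁ := ((96929 : ℝ) / 100000)) (σ₂ := ((7683 : ℝ) / 10000)) (E := ((45 : ℝ) / 37)) (Bc := ((4 : ℝ) / 44)) (Cc := ((4 : ℝ) / 74))
    (by linarith [hs99]) (by norm_num) ?_ ?_ ?_ (by norm_num) ?_ ?_ (by norm_num)
    (b₁ := ((1223 : ℝ) / 20000)) (a₂ := ((13107 : ℝ) / 50000)) (ρ₁ := ((411348111 : ℝ) / 1850000000)) (ρ₂ := ((411348111 : ℝ) / 1850000000)) (ρ₃ := ((369616511 : ℝ) / 1850000000)) (ρ₄ := ((369616511 : ℝ) / 1850000000))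
    (Or.inr (by norm_num)) (by norm_num) (by norm_num) (by norm_num)
    (fun h => absurd h (by norm_num)) (fun h => absurd h (by norm_num)) (fun h => absurd h (by norm_num)) (fun h => absurd h (by norm_num))
    (fun _ => by norm_num) (fun _ => by norm_num) (fun _ => by norm_num)
    (Or.inl (by norm_num)) (by norm_num) (by norm_num) (by norm_num) (by norm_num)
    hKL hRA hKA hKAtop he0 hea hεt hεrec
  · -- p₁⁴(k₂+1) ≤ 2
    have h1 : ((4591 : ℝ) / 10000) ^ 4 * ((k₂ : ℝ) + 1) ≤ ((4591 : ℝ) / 10000) ^ 4 * ((44 : ℝ) + 1) := mul_le_mul_of_nonneg_left (by linarith) (by positivity)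
    have h2 : ((4591 : ℝ) / 10000) ^ 4 * ((44 : ℝ) + 1) ≤ 2 := by norm_num
    linarith
  · -- p₂⁴(k₃+1) ≤ k₂+1
    have h1 : ((1051 : ℝ) / 1250) ^ 4 * ((k₃ : ℝ) + 1) ≤ ((1051 : ℝ) / 1250) ^ 4 * ((89 : ℝ) + 1) := mul_le_mul_of_nonneg_left (by linarith) (by positivity)
    have h2 : ((1051 : ℝ) / 1250) ^ 4 * ((89 : ℝ) + 1) ≤ (44 : ℝ) + 1 := by norm_num
    linarith
  · -- √2∕(1+p₁) ≤ σ₁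
    rw [div_le_iff₀ (by norm_num)]; linarith [hs99]
  · -- √2∕(1+p₂) ≤ σ₂
    rw [div_le_iff₀ (by norm_num)]; linarith [hs99]
  · -- 2(k₂+1)∕k₃ ≤ E
    rw [div_le_iff₀ hk3pos]; nlinarith [hk2hi', hk3lo']
  · -- 4∕k₂ ≤ B
    exact div_le_div_of_nonneg_left (by norm_num) (by norm_num) hk2lo'
  · -- 4∕k₃ ≤ C
    exact div_le_div_of_nonneg_left (by norm_num) (by norm_num) hk3lo'

end Summit.QuantumFields.BalabanUV.Beta.EriceRemainderEnclosureHistoryAutonomyComparisonAgeCompositionTwoPairsBandsG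

end
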